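import Mathlib
import HarnessLib
import Literature.Analysis.FluidPDE.VectorCalculus
import Literature.Analysis.FluidPDE.VectorCalculusProofs
import Literature.Analysis.FluidPDE.Vorticity
import Literature.Analysis.FluidPDE.VorticityEquation
import Literature.Analysis.FluidPDE.WholeSpaceIBP
import Literature.Analysis.FluidPDE.SpaceTimeCalculus
import Literature.Analysis.FluidPDE.AxisymmetricVorticityTransport
import Summits.NavierStokesRegularity.NavierStokesRegularity.Theorems.ImplosionDoorTangentialCurlFreeTrivialityBochner

/-!
# `ImplosionDoor.PassiveRadialVorticity` (stmt-NavierStokesRegularity-25305) — THE χ-TRANSPORT IDENTITY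
# (helper 1/2 for the research stub `stub_farPastWashout`, line `birth`, planner ns-idea-6)

For a classical solution `v` of the VORTICITY FORMULATION of Navier–Stokes (unit viscosity) on the open time
set `(−∞,0)` whose slices are SPHERE-TANGENTIAL (`⟪v(t,y), y⟫ = 0`), the radial vorticity moment
`χ(t,y) = ⟪ω(t,y), y⟫`, `ω = curl v`, is an exact PASSIVE SCALAR:

  `∂ₜχ = Δχ − v·∇χ`  pointwise on `(−∞,0) × ℝ³`  (`hasDerivAt_chi`).

PROOF (card item K1, route ImplosionDoor; three lines of calculus).  Dot the vorticity equation
`∂ₜω + (v·∇)ω = (ω·∇)v + Δω` with `y`: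
* `⟪∂ₜω, y⟫ = ∂ₜχ`;
* `⟪(v·∇)ω, y⟫ = v·∇χ − ⟪ω, v⟫` (Leibniz);
* `⟪(ω·∇)v, y⟫ = ⟪Dv·ω, y⟫ = −⟪v, ω⟫` — the differentiated tangency relation `⟪Dv(y)h, y⟫ = −⟪v(y), h⟫`
  (tree `…TangentialCurlFreeTrivialityBochner.inner_fderiv_apply_eq`), so the stretching term and the Leibniz
  remainder CANCEL;
* `⟪Δω, y⟫ = Δχ − 2 div ω = Δχ` (`laplacian_inner_self`, `div curl = 0`).

HONEST FRAMING: an identity for HYPOTHETICAL blow-up profiles (KNSS-type ancient mild solutions under the door's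
tangency hypothesis); nothing here bears on Navier–Stokes regularity; no summit statement is proved.
-/

noncomputable section

-- the summit and its single sub-problem share the name (CONVENTIONS §1), as in every Theorems file
set_option linter.dupNamespace false

namespace Summit.NavierStokesRegularity.NavierStokesRegularity.Theorems.ImplosionDoorPassiveRadialVorticityChiTransport

open Set Function
open scoped RealInnerProductSpace InnerProductSpace Topology Laplacian ContDiff
open Literature.Analysis Literature.Analysis.FluidPDE
open Summit.NavierStokesRegularity.NavierStokesRegularity.Theorems.ImplosionDoorTangentialCurlFreeTrivialityBochner

/-! ### `Δ⟪W, y⟫ = ⟪ΔW, y⟫ + 2 div W` -/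

/-- **Laplacian of a radial moment**: for a `C²` field `W` on `ℝ³`,
`Δ (y ↦ ⟪W(y), y⟫)(x) = ⟪ΔW(x), x⟫ + 2 div W(x)` (expand in an orthonormal frame:
`∂ᵢ⟪W, y⟫ = ⟪∂ᵢW, y⟫ + ⟪W, eᵢ⟫`, `∂ᵢ∂ᵢ⟪W, y⟫ = ⟪∂ᵢ∂ᵢW, y⟫ + 2⟪∂ᵢW, eᵢ⟫`). [folklore] -/
theorem laplacian_inner_self {W : EuclideanSpace ℝ (Fin 3) → EuclideanSpace ℝ (Fin 3)} (hW : ContDiff ℝ 2 W)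
    (x : EuclideanSpace ℝ (Fin 3)) :
    (Δ fun y => ⟪W y, y⟫) x = ⟪(Δ W) x, x⟫ + 2 * VectorCalculus.divergence W x := by
  set b := EuclideanSpace.basisFun (Fin 3) ℝ
  have hW1 : Differentiable ℝ W := hW.differentiable two_ne_zero
  have hWi : ∀ c, ContDiff ℝ 1 fun y => fderiv ℝ W y c := fun c =>
    (hW.fderiv_right (m := 1) le_rfl).clm_apply contDiff_const
  have hf : ContDiff ℝ 2 fun y : EuclideanSpace ℝ (Fin 3) => ⟪W y, y⟫ := hW.inner ℝ contDiff_id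
  -- first derivatives
  have h1 : ∀ i, (fun y => fderiv ℝ (fun y : EuclideanSpace ℝ (Fin 3) => ⟪W y, y⟫) y (b i)) =
      fun y => ⟪W y, b i⟫ + ⟪fderiv ℝ W y (b i), y⟫ := by
    intro i
    funext y
    have hid : DifferentiableAt ℝ (fun t : EuclideanSpace ℝ (Fin 3) => t) y := differentiableAt_id
    rw [fderiv_inner_apply ℝ (hW1 y) hid]
    simp
  rw [laplacian_eq_sum_fderiv_fderiv b hf x, laplacian_eq_sum_fderiv_fderiv b hW x,
    divergence_eq_sum_inner_fderiv b W x, sum_inner, Finset.mul_sum, ← Finset.sum_add_distrib]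
  refine Finset.sum_congr rfl fun i _ => ?_
  rw [h1 i]
  have hA : DifferentiableAt ℝ (fun y => ⟪W y, b i⟫) x := (hW1 x).inner ℝ (differentiableAt_const _)
  have hB : DifferentiableAt ℝ (fun y => ⟪fderiv ℝ W y (b i), y⟫) x :=
    ((hWi (b i)).differentiable one_ne_zero x).inner ℝ differentiableAt_id
  rw [fderiv_fun_add hA hB]
  have hid : DifferentiableAt ℝ (fun t : EuclideanSpace ℝ (Fin 3) => t) x := differentiableAt_id
  rw [add_apply, fderiv_inner_apply ℝ (hW1 x) (differentiableAt_const _),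
    fderiv_inner_apply ℝ ((hWi (b i)).differentiable one_ne_zero x) hid]
  simp only [fderiv_fun_const, Pi.zero_apply, zero_apply, inner_zero_right, zero_add,
    fderiv_fun_id, ContinuousLinearMap.coe_id', id_eq]
  rw [real_inner_comm (b i)]
  ring

/-! ### The radial vorticity moment of a vorticity solution -/

variable {v : ℝ → EuclideanSpace ℝ (Fin 3) → EuclideanSpace ℝ (Fin 3)}

/-- The radial vorticity moment `χ(t,y) = ⟪curl v(t)(y), y⟫` of a jointly smooth velocity is jointly smooth
(on a time set of unique differentiability). [folklore] -/
theorem isSmoothSpaceTimeOn_chi {S : Set ℝ} (hv : IsSmoothSpaceTimeOn S v) (hS : UniqueDiffOn ℝ S) :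
    IsSmoothSpaceTimeOn S fun t y => ⟪curl (v t) y, y⟫ := by
  have hω : IsSmoothSpaceTimeOn S (vorticity v) := hv.isSmoothSpaceTimeOn_vorticity hS
  have hid : IsSmoothSpaceTimeOn S fun (_ : ℝ) (y : EuclideanSpace ℝ (Fin 3)) => y :=
    isSmoothSpaceTimeOn_const_time contDiff_id S
  exact hω.inner hid

/-- **The χ-transport identity.**  For a vorticity solution `v` (unit viscosity) on `(−∞,0)` with
sphere-tangential slices, `χ(t,y) = ⟪curl v(t)(y), y⟫` satisfies `∂ₜχ(t,y) = Δχ(t,·)(y) − Dχ(t,·)(y)[v(t,y)]`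
for every `t < 0` and `y` (dot the vorticity equation with `y`; the stretching term `⟪Dv·ω, y⟫ = −⟪v, ω⟫`
cancels the Leibniz remainder of `⟪(v·∇)ω, y⟫`, and `⟪Δω, y⟫ = Δχ` since `div ω = 0`).
[cite: MajdaBertozziCUP2002, Prop. 2.4 eq. (2.110) (vorticity equation); folklore] -/
theorem hasDerivAt_chi (hV : IsVorticitySolutionOn (Iio (0 : ℝ)) 1 v)
    (htan : ∀ t < (0 : ℝ), ∀ y, ⟪v t y, y⟫ = 0) {t : ℝ} (ht : t < 0) (y : EuclideanSpace ℝ (Fin 3)) :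
    HasDerivAt (fun s => ⟪curl (v s) y, y⟫)
      ((Δ fun z => ⟪curl (v t) z, z⟫) y - fderiv ℝ (fun z => ⟪curl (v t) z, z⟫) y (v t y)) t := by
  have hS : IsOpen (Iio (0 : ℝ)) := isOpen_Iio
  have ht' : t ∈ Iio (0 : ℝ) := ht
  have hω : IsSmoothSpaceTimeOn (Iio (0 : ℝ)) (vorticity v) := hV.smooth_velocity.isSmoothSpaceTimeOn_vorticity hS.uniqueDiffOn
  -- smoothness of the slices
  have hvt : ContDiff ℝ ∞ (v t) := hV.smooth_velocity.contDiff_slice ht'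
  have hωt : ContDiff ℝ ∞ (curl (v t)) := hω.contDiff_slice ht'
  have hv2 : ContDiff ℝ 2 (v t) := hvt.of_le (by norm_cast)
  have hω2 : ContDiff ℝ 2 (curl (v t)) := hωt.of_le (by norm_cast)
  have hvd : Differentiable ℝ (v t) := hv2.differentiable two_ne_zero
  have hωd : Differentiable ℝ (curl (v t)) := hω2.differentiable two_ne_zero
  -- the time line of `ω(·, y)` and of `χ(·, y)`
  have hline : HasDerivAt (fun s => curl (v s) y) (deriv (fun s => curl (v s) y) t) t :=
    hω.hasDerivAt_timeLine hS ht' y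
  have hχline : HasDerivAt (fun s => ⟪curl (v s) y, y⟫) (⟪deriv (fun s => curl (v s) y) t, y⟫) t := by
    have := hline.inner ℝ (hasDerivAt_const t y)
    simpa using this
  -- the vorticity equation at `(t, y)`, dotted with `y`
  have heq := hV.vorticity_eq t ht' y
  rw [timeDerivWithin_eq_deriv hS ht', vorticity_apply, one_smul] at heq
  have heq' := congrArg (fun w : EuclideanSpace ℝ (Fin 3) => ⟪w, y⟫) heq
  simp only [inner_add_left, convect_apply, vorticity_apply] at heq'
  -- the four inner products
  have h2 : ⟪fderiv ℝ (curl (v t)) y (v t y), y⟫ =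
      fderiv ℝ (fun z => ⟪curl (v t) z, z⟫) y (v t y) - ⟪curl (v t) y, v t y⟫ := by
    have hid : DifferentiableAt ℝ (fun z : EuclideanSpace ℝ (Fin 3) => z) y := differentiableAt_id
    rw [fderiv_inner_apply ℝ (hωd y) hid]
    simp
  have h3 : ⟪fderiv ℝ (v t) y (curl (v t) y), y⟫ = -⟪v t y, curl (v t) y⟫ :=
    inner_fderiv_apply_eq hvd (htan t ht) y (curl (v t) y)
  have h4 : ⟪(Δ (curl (v t))) y, y⟫ = (Δ fun z => ⟪curl (v t) z, z⟫) y := by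
    rw [laplacian_inner_self hω2 y, divergence_curl_eq_zero_holds (v t) hv2 y]
    ring
  rw [h2, h3, h4, real_inner_comm (v t y)] at heq'
  convert hχline using 1
  linarith

end Summit.NavierStokesRegularity.NavierStokesRegularity.Theorems.ImplosionDoorPassiveRadialVorticityChiTransport

end
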